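import Summits.ResolutionOfSingularities.ResolutionOfSingularities.Theorems.SubfieldContactStalk
import Summits.ResolutionOfSingularities.ResolutionOfSingularities.Theorems.MaxContactCutSubfieldContact
import HarnessLib

/-!
# MaxContactCutSubfieldContactStalk — decomp-res node «SubfieldContact» (lens-6), generation 20: IN-CONE WIRING of
the KERNEL PROOF of `SubfieldContactAbs` (window-g20 item (M1), CRITIC-LEDGER rows 147b/147c/147d)

WRITER PROVENANCE (decomp-res-writer-1 g8, 2026-08-30T23:38:31Z): landed VERBATIM from
`HOME/decomp-res-lens-6/g20/wiring/MaxContactCutSubfieldContactStalk.lean` (sha256 14663cc7…) under CRITIC-LEDGER row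
152 (CLEARED); IN-CONE (imports the Theses cone via `MaxContactCutSubfieldContact`, never imported by the route file).
`scSubfieldContactAbs_holds` is the positive proof of the route item `MaxContactCut.SCSubfieldContactAbs`
(stmt-ResolutionOfSingularities-26970).

decomp-res lens-6 «barrier-complement carving», generation 20 (HOME = run/shared/lean/pub/decomp-res; node file
`HOME/decomp-res-lens-6/g20/SubfieldContactStalk.lean` = tree `Theorems/SubfieldContactStalk`, CONE-FREE; this file =
`HOME/decomp-res-lens-6/g20/wiring/MaxContactCutSubfieldContactStalk.lean`, INSIDE the Theses cone, never imported by
the route file).  The scratch check `HOME/decomp-res-lens-6/g20/scratch/WiringScratch.lean` (node content + this §13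
in one file) is the farm evidence until `Theorems/SubfieldContactStalk` has landed.

CONTENT (0 `sorry`, standard axioms): every wiring kernel of `MaxContactCutSubfieldContact` with its
`SubfieldContact(Abs)` binder DISCHARGED by `subfieldContactAbs_holds` / `subfieldContact_holds` —
`scSubfieldContactAbs_holds : MaxContactCut.SCSubfieldContactAbs` (item stmt-ResolutionOfSingularities-26970 CLOSED),
`e_one_iff_topNoAbs_of_items'`, `e_one_iff_noSubDvd_of_items'` (`E 1 ⟺ E1TopNoAbs ⟺ E1NoSubDvd` from the three
booked inputs of `E 5` ALONE), `scE1NoSubDvd_iff_e1TopNoAbs` (item 26971 ≡ `E1TopNoAbs`, no hypothesis),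
`e_one_of_scE1NoSubDvd_of_items` / `rungOne_of_scE1NoSubDvd_of_items` / `scE1NoSubDvd_of_e_one` (item 26971 + the
inputs of `E 5` ⟹ `E 1` ⟹ 29273 `RungOne`; `E 1` ⟹ item 26971), `worOn_not_dvd_of_items'` (EVERY marking coprime to
`p` is served), `wor_three_off3_of_items'`, `worPure_three_of_items_and_on3'` (marking 3, `p ≠ 3`, from X1 at 6 only).

(Sources: Matsumura1987 §26; EGAIV4 §16.8; Giraud1975; CossartJannsenSaito2020 Thm 1.4; CossartPiltant2008I Thm 2.1;
Cossart2011WeakMaximalContact; BenitoVillamayor2012; CossartPiltant2019; Kollar2007 §3.9.)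
-/

namespace Summit.ResolutionOfSingularities.ResolutionOfSingularities.Theorems.SubfieldContactClasses

open CategoryTheory AlgebraicGeometry TopologicalSpace
open Literature.AlgebraicGeometry.Resolution
open Summit.ResolutionOfSingularities.ResolutionOfSingularities.Theorems
open WeakOrderReduction ForcedTowerClasses PurityValveClasses

/-! ## §13 (generation 20) IN-CONE WIRING, HYPOTHESIS-FREE — the MaxContactCut items BY NAME

With `subfieldContactAbs_holds : SubfieldContactAbs` / `subfieldContact_holds : SubfieldContact` (file
`SubfieldContactStalk`, generation 20) the `(hS : SubfieldContact(Abs))` binder of every wiring kernel of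
`MaxContactCutSubfieldContact` is DISCHARGED: the booked prover target `MaxContactCut.SCSubfieldContactAbs`
(stmt-ResolutionOfSingularities-26970) holds outright, and the located-residual item `MaxContactCut.SCE1NoSubDvd`
(stmt-ResolutionOfSingularities-26971) is EXACTLY the host's remaining content modulo the three booked inputs of `E 5`
(X1 port `MarkedThreefoldResolution` 28616, the fact CJS-B, lens-5's `ExhaustionBridge`): it gives `E 1` (hence
29273 `RungOne`) and `E 1` gives it back; and it is, with NO hypothesis, the class `E1TopNoAbs` of data with a CLOSED
top point WITHOUT absolute stalk contact. -/

/-- **ITEM `MaxContactCut.SCSubfieldContactAbs` (stmt-ResolutionOfSingularities-26970) CLOSED**: the booked prover target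
of the node «SubfieldContact» holds outright (`subfieldContactAbs_holds`). [folklore] -/
theorem scSubfieldContactAbs_holds : Theses.MaxContactCut.SCSubfieldContactAbs :=
  subfieldContactAbs_holds

/-- `E 1 ⟺ E1TopNoAbs` from the three booked inputs of `E 5` ALONE (the `SubfieldContactAbs` binder of
`e_one_iff_topNoAbs_of_items` discharged). [folklore] -/
theorem e_one_iff_topNoAbs_of_items' (hM : Theses.MaxContactCut.MarkedThreefoldResolution)
    (hC : CossartJannsenSaito2020EmbeddedSequenceB.{0}) (hX : MaxContactCutExhaustion.ExhaustionBridge) :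
    E 1 ↔ E1TopNoAbs :=
  e_one_iff_topNoAbs_of_items subfieldContactAbs_holds hM hC hX

/-- `E 1 ⟺ E1NoSubDvd` from the three booked inputs of `E 5` ALONE (the `SubfieldContact` binder of
`e_one_iff_noSubDvd_of_items` discharged). [folklore] -/
theorem e_one_iff_noSubDvd_of_items' (hM : Theses.MaxContactCut.MarkedThreefoldResolution)
    (hC : CossartJannsenSaito2020EmbeddedSequenceB.{0}) (hX : MaxContactCutExhaustion.ExhaustionBridge) :
    E 1 ↔ E1NoSubDvd :=
  e_one_iff_noSubDvd_of_items subfieldContact_holds hM hC hX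

/-- The located-residual item IS the class `E1TopNoAbs`, hypothesis-free. [folklore] -/
theorem scE1NoSubDvd_iff_e1TopNoAbs : Theses.MaxContactCut.SCE1NoSubDvd ↔ E1TopNoAbs :=
  e1NoSubDvd_iff_e1TopNoAbs'

/-- The located-residual item and the booked inputs of `E 5` give the host family `E 1`. [folklore] -/
theorem e_one_of_scE1NoSubDvd_of_items (h : Theses.MaxContactCut.SCE1NoSubDvd)
    (hM : Theses.MaxContactCut.MarkedThreefoldResolution) (hC : CossartJannsenSaito2020EmbeddedSequenceB.{0})
    (hX : MaxContactCutExhaustion.ExhaustionBridge) : E 1 :=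
  (e_one_iff_noSubDvd_of_items' hM hC hX).2 h

/-- … hence the host item 29273 `RungOne` (`E 2 → E 1`). [folklore] -/
theorem rungOne_of_scE1NoSubDvd_of_items (h : Theses.MaxContactCut.SCE1NoSubDvd)
    (hM : Theses.MaxContactCut.MarkedThreefoldResolution) (hC : CossartJannsenSaito2020EmbeddedSequenceB.{0})
    (hX : MaxContactCutExhaustion.ExhaustionBridge) : Theses.MaxContactCut.RungOne :=
  fun _ => e_one_of_scE1NoSubDvd_of_items h hM hC hX

/-- EXACTNESS: the host family gives the located-residual item back (no hypothesis). [folklore] -/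
theorem scE1NoSubDvd_of_e_one (h : E 1) : Theses.MaxContactCut.SCE1NoSubDvd :=
  e1NoSubDvd_of_e_one h

/-- Every marking COPRIME to the characteristic is SERVED from the booked inputs of `E 5`: weak order reduction in
dimension four at order `n` for all data over all fields of characteristic `p ∤ n`. [folklore] -/
theorem worOn_not_dvd_of_items' (hM : Theses.MaxContactCut.MarkedThreefoldResolution)
    (hC : CossartJannsenSaito2020EmbeddedSequenceB.{0}) (hX : MaxContactCutExhaustion.ExhaustionBridge) {n : ℕ}
    (hn : 1 ≤ n) : WOROn (fun p => ¬ p ∣ n) n :=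
  worOn_not_dvd_of_five' hn (MaxContactCutTauLadder.e_five_of_items hM hC hX n hn)

/-- Marking `3`, `p ≠ 3`: served from lens-5's bridge at 3, the port X1 at `3! = 6` ONLY and CJS-B — no hugging
law, no `SubfieldContact` hypothesis. [folklore] -/
theorem wor_three_off3_of_items' (hX : MaxContactCutExhaustion.ExhaustionBridge)
    (hM : MaxContactCutExhaustion.MarkedThreefoldResolutionAt (Nat.factorial 3))
    (hC : CossartJannsenSaito2020EmbeddedSequenceB.{0}) : WOROn (· ≠ 3) 3 :=
  wor_three_off3' (seqDimFour_five_three_of_items hX hM hC)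

/-- `WORPure 3 ⟸ ExhaustionBridge ∧ X1(6) ∧ CJS-B ∧ (p = 3 column)` — the `SubfieldContact` binder of
`worPure_three_of_items_and_on3` discharged. [folklore] -/
theorem worPure_three_of_items_and_on3' (hX : MaxContactCutExhaustion.ExhaustionBridge)
    (hM : MaxContactCutExhaustion.MarkedThreefoldResolutionAt (Nat.factorial 3))
    (hC : CossartJannsenSaito2020EmbeddedSequenceB.{0}) (h3 : WORPureOn (· = 3) 3) : WORPure 3 :=
  worPure_three_of_items_and_on3 subfieldContact_holds hX hM hC h3

end Summit.ResolutionOfSingularities.ResolutionOfSingularities.Theorems.SubfieldContactClasses
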